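import Summits.Ventures.CertifiedQuantumChemistry.Rows.SpinFlipQuotientLossless
import HarnessLib

/-!
# Ventures/CertifiedQuantumChemistry — Rows/SpinFlipQuotientLosslessT.lean: the `M = 0` spin-flip quotient
# is LOSSLESS at the `DQGT1T2′` rung

HONEST FRAMING (verbatim): certified bounds for a stated model Hamiltonian in a stated basis; not a
claim about the real molecule beyond that model.

Seat rdm-B (generator B `--flip`), ROWS courtesy file; the three-index companion of
`Rows/SpinFlipQuotientLossless.lean` (DQG rung), same proof shape, for the cell's strongest rung (the
`flip` legs of record at `DQGT1T2′`, e.g. CERTIFIED #152–#154): the `T1` / `T2` / `T2′` functionals of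
`Literature/…/ThreeIndexRelaxationBound.lean` on an abstract pair `(γ, Γ)` are EQUIVARIANT under any index
bijection (`t1Map_submatrix`, `t2Map_submatrix`, `t2PrimeMap_submatrix`) and AFFINE (`t1Map_midpoint`,
`t2Map_midpoint`, `t2PrimeMap_midpoint`); hence the sector-`DQGT1T2′`-feasible set is `θ`-covariant
(`isDQGT1T2PrimeFeasibleSector_spinSwap`: `(a, b) ↦ (b, a)`) and midpoint-convex
(`isDQGT1T2PrimeFeasibleSector_midpoint`), and **`exists_flipSymmetric_of_isDQGT1T2PrimeFeasibleSector`** /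
**`forall_isDQGT1T2PrimeFeasibleSector_iff_forall_flipSymmetric`**: at `(n, n)` every feasible pair has a
`θ`-symmetric feasible partner of the same energy, so a real number lies below the energy functional on
all sector-`DQGT1T2′`-feasible pairs iff it does so on the `θ`-symmetric ones (FORMAT-qcl1 §8c LOSSLESS
"the two optima are EQUAL", in bound form). Everything is PROVED (0 sorry, 0 def); nothing asserts a
bound about any model; no claim node. References: FORMAT-qcl1 v0.3.0 §8c; M. Nakata et al., J. Chem.
Phys. 128 (2008) 164113 §II.A–C (`T1`, `T2`, `T2′`).
-/

noncomputable section

namespace Summit.Ventures.CertifiedQuantumChemistry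

open Matrix Finset
open Literature.MathematicalPhysics.QuantumLattice Literature.MathematicalPhysics.QuantumChemistry
open scoped ComplexOrder

/-! ## §1 Equivariance and affinity of the three-index maps -/

section ThreeIndex

variable {ι : Type*} [LinearOrder ι]

/-- **`T1` is equivariant** under a simultaneous relabelling of all indices. -/
theorem t1Map_submatrix (e : ι ≃ ι) (γ : Matrix ι ι ℂ) (Γ : Matrix (ι × ι) (ι × ι) ℂ) :
    t1Map (γ.submatrix e e) (Γ.submatrix (Prod.map e e) (Prod.map e e)) =
      (t1Map γ Γ).submatrix (Prod.map e (Prod.map e e)) (Prod.map e (Prod.map e e)) := by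
  ext ⟨i, j, k⟩ ⟨l, m, n⟩
  simp only [Matrix.submatrix_apply, Prod.map_apply, t1Map_apply, EmbeddingLike.apply_eq_iff_eq]

/-- **`T2` is equivariant** under a simultaneous relabelling of all indices. -/
theorem t2Map_submatrix (e : ι ≃ ι) (γ : Matrix ι ι ℂ) (Γ : Matrix (ι × ι) (ι × ι) ℂ) :
    t2Map (γ.submatrix e e) (Γ.submatrix (Prod.map e e) (Prod.map e e)) =
      (t2Map γ Γ).submatrix (Prod.map e (Prod.map e e)) (Prod.map e (Prod.map e e)) := by
  ext ⟨i, j, k⟩ ⟨l, m, n⟩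
  simp only [Matrix.submatrix_apply, Prod.map_apply, t2Map_apply, EmbeddingLike.apply_eq_iff_eq]

/-- **`T2′` is equivariant** under a simultaneous relabelling of all indices (block by block). -/
theorem t2PrimeMap_submatrix (e : ι ≃ ι) (γ : Matrix ι ι ℂ) (Γ : Matrix (ι × ι) (ι × ι) ℂ) :
    t2PrimeMap (γ.submatrix e e) (Γ.submatrix (Prod.map e e) (Prod.map e e)) =
      (t2PrimeMap γ Γ).submatrix (Sum.map (Prod.map e (Prod.map e e)) e)
        (Sum.map (Prod.map e (Prod.map e e)) e) := by
  ext (⟨i, j, k⟩ | l) (⟨l', m, n⟩ | m')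
  · simp only [t2PrimeMap, Matrix.submatrix_apply, Sum.map_inl, fromBlocks_apply₁₁, Prod.map_apply]
    rw [t2Map_submatrix]
    rfl
  · simp only [t2PrimeMap, Matrix.submatrix_apply, Sum.map_inl, Sum.map_inr, fromBlocks_apply₁₂,
      Matrix.of_apply, Prod.map_apply]
  · simp only [t2PrimeMap, Matrix.submatrix_apply, Sum.map_inl, Sum.map_inr, fromBlocks_apply₂₁,
      Matrix.of_apply, Prod.map_apply]
  · simp only [t2PrimeMap, Matrix.submatrix_apply, Sum.map_inr, fromBlocks_apply₂₂]

/-- `T1` is affine: it commutes with midpoints. -/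
theorem t1Map_midpoint (γ γ' : Matrix ι ι ℂ) (Γ Γ' : Matrix (ι × ι) (ι × ι) ℂ) :
    t1Map ((1 / 2 : ℂ) • (γ + γ')) ((1 / 2 : ℂ) • (Γ + Γ')) = (1 / 2 : ℂ) • (t1Map γ Γ + t1Map γ' Γ') := by
  ext ⟨i, j, k⟩ ⟨l, m, n⟩
  simp only [Matrix.smul_apply, Matrix.add_apply, t1Map_apply, smul_eq_mul]
  ring

/-- `T2` is affine: it commutes with midpoints. -/
theorem t2Map_midpoint (γ γ' : Matrix ι ι ℂ) (Γ Γ' : Matrix (ι × ι) (ι × ι) ℂ) :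
    t2Map ((1 / 2 : ℂ) • (γ + γ')) ((1 / 2 : ℂ) • (Γ + Γ')) = (1 / 2 : ℂ) • (t2Map γ Γ + t2Map γ' Γ') := by
  ext ⟨i, j, k⟩ ⟨l, m, n⟩
  simp only [Matrix.smul_apply, Matrix.add_apply, t2Map_apply, smul_eq_mul]
  ring

/-- `T2′` is affine: it commutes with midpoints (block by block). -/
theorem t2PrimeMap_midpoint (γ γ' : Matrix ι ι ℂ) (Γ Γ' : Matrix (ι × ι) (ι × ι) ℂ) :
    t2PrimeMap ((1 / 2 : ℂ) • (γ + γ')) ((1 / 2 : ℂ) • (Γ + Γ')) =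
      (1 / 2 : ℂ) • (t2PrimeMap γ Γ + t2PrimeMap γ' Γ') := by
  rw [t2PrimeMap, t2Map_midpoint, t2PrimeMap, t2PrimeMap, fromBlocks_add, fromBlocks_smul]
  congr 1

end ThreeIndex

/-! ## §2 The `DQGT1T2′` sector-feasible set under the flip; LOSSLESS -/

section Flip

variable {Λ : Type*} [LinearOrder Λ] [Fintype Λ]

/-- **Sector-`DQGT1T2′` feasibility is `θ`-covariant**: `(a, b) ↦ (b, a)`. -/
theorem isDQGT1T2PrimeFeasibleSector_spinSwap {a b : ℕ} {γ : Matrix (Orb Λ) (Orb Λ) ℂ}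
    {Γ : Matrix (Orb Λ × Orb Λ) (Orb Λ × Orb Λ) ℂ} (h : IsDQGT1T2PrimeFeasibleSector a b γ Γ) :
    IsDQGT1T2PrimeFeasibleSector b a (γ.submatrix Orb.spinSwap Orb.spinSwap)
      (Γ.submatrix (Prod.map Orb.spinSwap Orb.spinSwap) (Prod.map Orb.spinSwap Orb.spinSwap)) where
  toIsDQGFeasibleSector := isDQGFeasibleSector_spinSwap h.toIsDQGFeasibleSector
  t1_psd := by rw [t1Map_submatrix]; exact h.t1_psd.submatrix _
  t2Prime_psd := by rw [t2PrimeMap_submatrix]; exact h.t2Prime_psd.submatrix _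

/-- **The sector-`DQGT1T2′` feasible set is (midpoint-)convex.** -/
theorem isDQGT1T2PrimeFeasibleSector_midpoint {a b : ℕ} {γ γ' : Matrix (Orb Λ) (Orb Λ) ℂ}
    {Γ Γ' : Matrix (Orb Λ × Orb Λ) (Orb Λ × Orb Λ) ℂ} (h : IsDQGT1T2PrimeFeasibleSector a b γ Γ)
    (h' : IsDQGT1T2PrimeFeasibleSector a b γ' Γ') :
    IsDQGT1T2PrimeFeasibleSector a b ((1 / 2 : ℂ) • (γ + γ')) ((1 / 2 : ℂ) • (Γ + Γ')) where
  toIsDQGFeasibleSector := isDQGFeasibleSector_midpoint h.toIsDQGFeasibleSector h'.toIsDQGFeasibleSector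
  t1_psd := by rw [t1Map_midpoint]; exact posSemidef_midpoint h.t1_psd h'.t1_psd
  t2Prime_psd := by rw [t2PrimeMap_midpoint]; exact posSemidef_midpoint h.t2Prime_psd h'.t2Prime_psd

/-- **LOSSLESS (FORMAT-qcl1 §8c), `DQGT1T2′` rung**: every sector-`DQGT1T2′`-feasible pair at `(n, n)`
has a `θ`-SYMMETRIC sector-`DQGT1T2′`-feasible partner (its `θ`-average) with the same energy for
every spin-free integral table. -/
theorem exists_flipSymmetric_of_isDQGT1T2PrimeFeasibleSector {n : ℕ} {γ : Matrix (Orb Λ) (Orb Λ) ℂ}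
    {Γ : Matrix (Orb Λ × Orb Λ) (Orb Λ × Orb Λ) ℂ} (hγ : IsDQGT1T2PrimeFeasibleSector n n γ Γ) :
    ∃ (γ' : Matrix (Orb Λ) (Orb Λ) ℂ) (Γ' : Matrix (Orb Λ × Orb Λ) (Orb Λ × Orb Λ) ℂ),
      IsDQGT1T2PrimeFeasibleSector n n γ' Γ' ∧
      (∀ i k, γ' (Orb.spinSwap i) (Orb.spinSwap k) = γ' i k) ∧
      (∀ i j k' l, Γ' (Orb.spinSwap i, Orb.spinSwap j) (Orb.spinSwap k', Orb.spinSwap l) =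
        Γ' (i, j) (k', l)) ∧
      ∀ (h : Λ → Λ → ℂ) (g : Λ → Λ → Λ → Λ → ℂ) (hnuc : ℂ),
        rdmEnergy h g hnuc γ' Γ' = rdmEnergy h g hnuc γ Γ := by
  refine ⟨(1 / 2 : ℂ) • (γ + γ.submatrix Orb.spinSwap Orb.spinSwap),
    (1 / 2 : ℂ) • (Γ + Γ.submatrix (Prod.map Orb.spinSwap Orb.spinSwap)
      (Prod.map Orb.spinSwap Orb.spinSwap)),
    isDQGT1T2PrimeFeasibleSector_midpoint hγ (isDQGT1T2PrimeFeasibleSector_spinSwap hγ), fun i k => ?_,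
    fun i j k' l => ?_, fun h g hnuc => ?_⟩
  · simp only [Matrix.smul_apply, Matrix.add_apply, Matrix.submatrix_apply, spinSwap_spinSwap, add_comm]
  · simp only [Matrix.smul_apply, Matrix.add_apply, Matrix.submatrix_apply, Prod.map_apply,
      spinSwap_spinSwap, add_comm]
  · rw [rdmEnergy_midpoint, rdmEnergy_submatrix_spinSwap]
    ring

/-- **The quotient and the full programme certify the same numbers, `DQGT1T2′` rung**: a real number lies
below the energy functional on ALL sector-`DQGT1T2′`-feasible pairs at `(n, n)` iff it lies below it on
the `θ`-SYMMETRIC ones. -/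
theorem forall_isDQGT1T2PrimeFeasibleSector_iff_forall_flipSymmetric (h : Λ → Λ → ℂ)
    (g : Λ → Λ → Λ → Λ → ℂ) (hnuc : ℂ) (n : ℕ) (c : ℝ) :
    (∀ γ Γ, IsDQGT1T2PrimeFeasibleSector n n γ Γ → c ≤ (rdmEnergy h g hnuc γ Γ).re) ↔
      ∀ γ Γ, IsDQGT1T2PrimeFeasibleSector n n γ Γ →
        (∀ i k, γ (Orb.spinSwap i) (Orb.spinSwap k) = γ i k) →
        (∀ i j k' l, Γ ((Orb.spinSwap : Orb Λ ≃ Orb Λ) i, Orb.spinSwap j) (Orb.spinSwap k', Orb.spinSwap l) =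
          Γ (i, j) (k', l)) →
        c ≤ (rdmEnergy h g hnuc γ Γ).re := by
  refine ⟨fun hc γ Γ hf _ _ => hc γ Γ hf, fun hc γ Γ hf => ?_⟩
  obtain ⟨γ', Γ', hf', hγ', hΓ', hE⟩ := exists_flipSymmetric_of_isDQGT1T2PrimeFeasibleSector hf
  rw [← hE h g hnuc]
  exact hc γ' Γ' hf' hγ' hΓ'

end Flip

end Summit.Ventures.CertifiedQuantumChemistry

end
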